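import Literature.Analysis.Calculus.CylinderHomotopyOperator
import Literature.Analysis.Calculus.ParametricIntervalIntegralWithin
import HarnessLib

/-!
# The cylinder homotopy operator WITHIN a locally convex parameter set (Lee, Lemma 17.9, one-sided)

Topic `Analysis/Calculus`.  Everything here is proved; no named facts, no new constructions (the
operator is the tree's `cylinderPrimitive` of `CylinderHomotopyOperator.lean`).  That file proves
Lee's homotopy formula `d(hω) + h(dω) = i₁^* ω - i₀^* ω` for a form `ω` of class `C¹` on an OPEN set
`Ω ⊇ {x} × [0, 1]` of `E × ℝ`.  On a manifold WITH boundary or corners the chart representatives of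
forms are smooth only WITHIN `(O ∩ range I) × ℝ`, `range I` convex with non-empty interior, and
Mathlib's `d` there is `extDerivWithin`.  This file is the one-sided version: for `S ⊆ E` locally
convex and of unique differentiability and `ω` of class `Cᵐ` on `S × ℝ` (within),

* `contDiffOn_cylinderPrimitive_within` — `hω` is `Cᵐ` on `S`;
* `hasFDerivWithinAt_cylinderPrimitive` — `D(hω)|_S(x) = ∫₀¹ ∂ₓ[i_t^*(S ⌟ ω)]|_S (x) dt`
  (`partialFDerivWithinFst_cylinderIntegrand`);
* `extDerivWithin_cylinderPrimitive_add_apply` / `extDerivWithin_cylinderPrimitive_of_closed` —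
  **`d_S(hω)(x) + h(d_{S×ℝ} ω)(x) = i₁^* ω(x) - i₀^* ω(x)`** for `x ∈ S`, and the closed case,

by Lee's computation verbatim (Cartan's formula in the `t`-slot, the alternating sums cancel, the
fundamental theorem of calculus), the `x`-derivative under the integral sign being the tree's
`hasFDerivWithinAt_intervalIntegral_within` (`ParametricIntervalIntegralWithin.lean`,
Dieudonné (8.11.2) one-sided).  Consumer: homotopy invariance of de Rham cohomology for manifolds
with corners (`DeRhamHomotopyInvariance.lean`).

## References

* J. M. Lee, *Introduction to Smooth Manifolds*, 2nd ed., GTM 218 (2012), Ch. 17, Lemma 17.9 with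
  (17.4)–(17.5) ("For any smooth manifold `M` with or without boundary"). [Lee2012]
* J. Dieudonné, *Foundations of Modern Analysis* (1960), (8.11.2). [Dieudonne1960]
-/

noncomputable section

open Set MeasureTheory intervalIntegral Filter Topology Function Metric
open scoped Interval

namespace Literature.Analysis.Calculus

universe u v

variable {E : Type u} [NormedAddCommGroup E] [NormedSpace ℝ E]
  {F : Type v} [NormedAddCommGroup F] [NormedSpace ℝ F] {n : ℕ}

/-! ### Algebra: Mathlib's alternatization with the first slot separated -/

section Algebra

omit [NormedAddCommGroup E] [NormedSpace ℝ E] in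
/-- Removing the entry `i+1` of `(u, v)` removes the entry `i` of `v`. [cite: Lee2012, Ch. 17, Lemma 17.9 (proof)] -/
private theorem removeNth_succ_vecCons' (u : E) (v : Fin (n + 1) → E) (i : Fin (n + 1)) :
    Fin.removeNth i.succ (Matrix.vecCons u v) = Matrix.vecCons u (Fin.removeNth i v) := by
  funext j
  refine Fin.cases ?_ (fun k => ?_) j
  · simp [Fin.removeNth]
  · simp [Fin.removeNth, Fin.succ_succAbove_succ]

omit [NormedAddCommGroup E] [NormedSpace ℝ E] in
/-- Removing the entry `0` of `(u, v)` gives `v`. [cite: Lee2012, Ch. 17, Lemma 17.9 (proof)] -/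
private theorem removeNth_zero_vecCons' (u : E) (v : Fin (n + 1) → E) :
    Fin.removeNth 0 (Matrix.vecCons u v) = v := by
  funext j; simp [Fin.removeNth]

/-- **`alt(T)(u, v) = T(u)(v) - ∑ᵢ (-1)ⁱ T(vᵢ)(u, v̂ᵢ)`** — Mathlib's `alternatizeUncurryFin` (the
normalisation of `extDeriv` / `extDerivWithin`) with the first slot separated (the tree's
`extDeriv_apply_vecCons`, stated for the linear map). [cite: Lee2012, Ch. 17, Lemma 17.9 (proof)] -/
theorem alternatizeUncurryFin_apply_vecCons (T : E →L[ℝ] E [⋀^Fin (n + 1)]→L[ℝ] F) (u : E)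
    (v : Fin (n + 1) → E) :
    ContinuousAlternatingMap.alternatizeUncurryFin T (Matrix.vecCons u v) =
      T u v - ∑ i : Fin (n + 1), (-1 : ℝ) ^ (i : ℕ) • T (v i) (Matrix.vecCons u (i.removeNth v)) := by
  rw [ContinuousAlternatingMap.alternatizeUncurryFin_apply, Fin.sum_univ_succ]
  simp only [negOnePow_zsmul_eq, Fin.val_zero, pow_zero, one_smul, Matrix.cons_val_zero,
    removeNth_zero_vecCons', Fin.val_succ, pow_succ, Matrix.cons_val_succ, removeNth_succ_vecCons',
    mul_neg, mul_one, neg_smul, Finset.sum_neg_distrib]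
  rw [sub_eq_add_neg]

/-- **`d_s ω(x)(u, v) = D_s ω(x)(u)(v) - ∑ᵢ (-1)ⁱ D_s ω(x)(vᵢ)(u, v̂ᵢ)`** at a point of unique
differentiability (`extDerivWithin`, first slot separated). [cite: Lee2012, Ch. 17, Lemma 17.9 (proof)] -/
theorem extDerivWithin_apply_vecCons {E' : Type*} [NormedAddCommGroup E'] [NormedSpace ℝ E']
    {ω : E' → E' [⋀^Fin (n + 1)]→L[ℝ] F} {s : Set E'} {x : E'}
    {ω' : E' →L[ℝ] E' [⋀^Fin (n + 1)]→L[ℝ] F} (h : HasFDerivWithinAt ω ω' s x)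
    (hs : UniqueDiffWithinAt ℝ s x) (u : E') (v : Fin (n + 1) → E') :
    extDerivWithin ω s x (Matrix.vecCons u v) =
      ω' u v - ∑ i : Fin (n + 1), (-1 : ℝ) ^ (i : ℕ) • ω' (v i) (Matrix.vecCons u (i.removeNth v)) := by
  rw [extDerivWithin, h.fderivWithin hs, alternatizeUncurryFin_apply_vecCons]

end Algebra

/-! ### Regularity within `S` -/

section Regularity

variable {ω : E × ℝ → (E × ℝ) [⋀^Fin (n + 1)]→L[ℝ] F} {S : Set E}

/-- **`h ω` is `Cᵐ` on `S` when `ω` is `Cᵐ` on `S × ℝ` (within)**, `S` locally convex of unique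
differentiability (Lee: "for any smooth manifold with or without boundary … the integral defines a
smooth form"; `contDiffOn_intervalIntegral_within`). [cite: Lee2012, Ch. 17, Lemma 17.9 (proof)] -/
theorem contDiffOn_cylinderPrimitive_within (hSc : ∀ x ∈ S, ∃ ε > 0, Convex ℝ (S ∩ ball x ε))
    (hSu : UniqueDiffOn ℝ S) {m : ℕ∞} (hω : ContDiffOn ℝ m ω (S ×ˢ univ)) :
    ContDiffOn ℝ m (cylinderPrimitive ω) S :=
  contDiffOn_intervalIntegral_within (G := E [⋀^Fin n]→L[ℝ] F) (H := cylinderIntegrand ω) hSc hSu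
    zero_le_one (contDiffOn_uncurry_cylinderIntegrand hω)

/-- **Differentiation under the integral sign for `h ω`, within `S`.** [cite: Lee2012, Ch. 17, Lemma 17.9 (proof)] -/
theorem hasFDerivWithinAt_cylinderPrimitive (hSc : ∀ x ∈ S, ∃ ε > 0, Convex ℝ (S ∩ ball x ε))
    (hSu : UniqueDiffOn ℝ S) {m : WithTop ℕ∞} (hω : ContDiffOn ℝ m ω (S ×ˢ univ)) (hm : 1 ≤ m)
    {x : E} (hx : x ∈ S) :
    HasFDerivWithinAt (cylinderPrimitive ω)
      (∫ t in (0 : ℝ)..1, partialFDerivWithinFst S (cylinderIntegrand ω) x t) S x :=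
  hasFDerivWithinAt_intervalIntegral_within hSc hSu (contDiffOn_uncurry_cylinderIntegrand hω) hm
    zero_le_one hx

/-- `∂ₓ[i_t^*(S ⌟ ω)]|_S (x) = i^*(S ⌟ ·) ∘ D_{S×ℝ} ω(x, t) ∘ (v ↦ (v, 0))`.
[cite: Lee2012, Ch. 17, Lemma 17.9 (proof)] -/
theorem partialFDerivWithinFst_cylinderIntegrand (hSu : UniqueDiffOn ℝ S) {x : E} (hx : x ∈ S)
    {t : ℝ} (hω : DifferentiableWithinAt ℝ ω (S ×ˢ univ) (x, t)) :
    partialFDerivWithinFst S (cylinderIntegrand ω) x t =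
      (cylinderCLM E F n).comp ((fderivWithin ℝ ω (S ×ˢ univ) (x, t)).comp
        (ContinuousLinearMap.inl ℝ E ℝ)) := by
  have hu : UniqueDiffWithinAt ℝ (S ×ˢ (univ : Set ℝ)) (x, t) :=
    (hSu.prod uniqueDiffOn_univ) _ ⟨hx, mem_univ t⟩
  have h := ((cylinderCLM E F n).hasFDerivAt.comp_hasFDerivWithinAt (x, t)
    hω.hasFDerivWithinAt).fderivWithin hu
  unfold partialFDerivWithinFst
  rw [uncurry_cylinderIntegrand, show (fun p : E × ℝ => cylinderCLM E F n (ω p)) =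
    ⇑(cylinderCLM E F n) ∘ ω from rfl, h]
  rfl

end Regularity

/-! ### Lee's homotopy formula within `S` -/

section HomotopyFormula

variable [CompleteSpace F] {ω : E × ℝ → (E × ℝ) [⋀^Fin (n + 1)]→L[ℝ] F} {S : Set E}

omit [CompleteSpace F] in
/-- The slices `t ↦ ω(x, t)(w)`, `x ∈ S`, have `t`-derivative `D_{S×ℝ} ω(x, t)(0, 1)(w)` (the vertical
direction lies inside `S × ℝ`). [cite: Lee2012, Ch. 17, Lemma 17.9 (17.5)] -/
theorem hasDerivAt_apply_slice_within {x : E} (hx : x ∈ S) {t : ℝ}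
    (hω : DifferentiableWithinAt ℝ ω (S ×ˢ univ) (x, t)) (w : Fin (n + 1) → E × ℝ) :
    HasDerivAt (fun s : ℝ => ω (x, s) w)
      (fderivWithin ℝ ω (S ×ˢ univ) (x, t) ((0 : E), (1 : ℝ)) w) t := by
  have h1 : HasDerivWithinAt (fun s : ℝ => ((x, s) : E × ℝ)) ((0 : E), (1 : ℝ)) univ t :=
    ((hasDerivAt_const t x).prodMk (hasDerivAt_id t)).hasDerivWithinAt
  have h2 : HasDerivWithinAt (fun s : ℝ => ω (x, s))
      (fderivWithin ℝ ω (S ×ˢ univ) (x, t) ((0 : E), (1 : ℝ))) univ t :=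
    hω.hasFDerivWithinAt.comp_hasDerivWithinAt t h1 fun s _ => ⟨hx, mem_univ s⟩
  exact ((ContinuousAlternatingMap.apply ℝ (E × ℝ) F w).hasFDerivAt.comp_hasDerivWithinAt t
    h2).hasDerivAt (Filter.univ_mem)

omit [NormedAddCommGroup E] [NormedSpace ℝ E] [CompleteSpace F] in
/-- Removing an entry commutes with the horizontal lift `v ↦ (v, 0)`. [cite: Lee2012, Ch. 17, Lemma 17.9 (proof)] -/
private theorem removeNth_horizontal' (i : Fin (n + 1)) (v : Fin (n + 1) → E) :
    i.removeNth (fun j => ((v j, 0) : E × ℝ)) = fun j => (i.removeNth v j, 0) :=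
  rfl

omit [CompleteSpace F] in
/-- The pointwise cancellation of the two alternating sums in `d(hω) + h(dω)`.
[cite: Lee2012, Ch. 17, Lemma 17.9 (17.5)] -/
private theorem integrand_cancel' (T : (E × ℝ) →L[ℝ] (E × ℝ) [⋀^Fin (n + 1)]→L[ℝ] F)
    (v : Fin (n + 1) → E) :
    (∑ i : Fin (n + 1), (-1 : ℝ) ^ (i : ℕ) •
        T (v i, 0) (Matrix.vecCons ((0 : E), (1 : ℝ)) fun j => (i.removeNth v j, 0))) +
      (T ((0 : E), (1 : ℝ)) (fun i => (v i, 0)) -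
        ∑ i : Fin (n + 1), (-1 : ℝ) ^ (i : ℕ) •
          T (v i, 0) (Matrix.vecCons ((0 : E), (1 : ℝ)) (i.removeNth fun j => (v j, 0)))) =
      T ((0 : E), (1 : ℝ)) (fun i => (v i, 0)) := by
  simp only [removeNth_horizontal']
  abel

/-- **Lee's homotopy formula within `S`, evaluated**: for `ω` of class `C¹` on `S × ℝ` (within),
`S` locally convex of unique differentiability, and `x ∈ S`,
`d_S(hω)(x)(v) + h(d_{S×ℝ} ω)(x)(v) = ω(x, 1)(v, 0) - ω(x, 0)(v, 0)`.
[cite: Lee2012, Ch. 17, Lemma 17.9 (17.4)] -/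
theorem extDerivWithin_cylinderPrimitive_add_apply
    (hSc : ∀ x ∈ S, ∃ ε > 0, Convex ℝ (S ∩ ball x ε)) (hSu : UniqueDiffOn ℝ S)
    (hω : ContDiffOn ℝ 1 ω (S ×ˢ univ)) {x : E} (hx : x ∈ S) (v : Fin (n + 1) → E) :
    extDerivWithin (cylinderPrimitive ω) S x v +
        cylinderPrimitive (extDerivWithin ω (S ×ˢ univ)) x v =
      ω (x, 1) (fun i => (v i, 0)) - ω (x, 0) (fun i => (v i, 0)) := by
  have hSu' : UniqueDiffOn ℝ (S ×ˢ (univ : Set ℝ)) := hSu.prod uniqueDiffOn_univ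
  -- the derivative of `ω` within `S × ℝ` along the segment and its continuity
  have hdiff : ∀ t : ℝ, DifferentiableWithinAt ℝ ω (S ×ˢ univ) (x, t) := fun t =>
    hω.differentiableOn one_ne_zero (x, t) ⟨hx, mem_univ t⟩
  have hderW : ∀ t : ℝ, HasFDerivWithinAt ω (fderivWithin ℝ ω (S ×ˢ univ) (x, t)) (S ×ˢ univ) (x, t) :=
    fun t => (hdiff t).hasFDerivWithinAt
  have hDc : ContinuousOn (fderivWithin ℝ ω (S ×ˢ univ)) (S ×ˢ univ) :=
    hω.continuousOn_fderivWithin hSu' le_rfl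
  have hDt : Continuous fun t : ℝ => fderivWithin ℝ ω (S ×ˢ univ) (x, t) :=
    hDc.comp_continuous (Continuous.prodMk_right x) fun t => ⟨hx, mem_univ t⟩
  have hDt_apply : ∀ (u : E × ℝ) (m : Fin (n + 1) → E × ℝ),
      Continuous fun t : ℝ => fderivWithin ℝ ω (S ×ˢ univ) (x, t) u m := fun u m =>
    (ContinuousAlternatingMap.apply ℝ (E × ℝ) F m).continuous.comp (hDt.clm_apply continuous_const)
  -- integrability of the two integrands
  have hcA : Continuous fun t : ℝ => ∑ i : Fin (n + 1), (-1 : ℝ) ^ (i : ℕ) •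
      fderivWithin ℝ ω (S ×ˢ univ) (x, t) (v i, 0)
        (Matrix.vecCons ((0 : E), (1 : ℝ)) fun j => (i.removeNth v j, 0)) :=
    continuous_finsetSum _ fun i _ => (hDt_apply _ _).const_smul _
  have hcB : Continuous fun t : ℝ =>
      fderivWithin ℝ ω (S ×ˢ univ) (x, t) ((0 : E), (1 : ℝ)) (fun i => (v i, 0)) -
        ∑ i : Fin (n + 1), (-1 : ℝ) ^ (i : ℕ) • fderivWithin ℝ ω (S ×ˢ univ) (x, t) (v i, 0)
          (Matrix.vecCons ((0 : E), (1 : ℝ)) (i.removeNth fun j => (v j, 0))) :=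
    (hDt_apply _ _).sub (continuous_finsetSum _ fun i _ => (hDt_apply _ _).const_smul _)
  have hiA := hcA.intervalIntegrable (μ := volume) (0 : ℝ) 1
  have hiB := hcB.intervalIntegrable (μ := volume) (0 : ℝ) 1
  -- (1) `d_S(hω)(x)(v) = ∫₀¹ ∑ᵢ (-1)ⁱ D ω(x,t)(vᵢ,0)((0,1), (v̂ᵢ, 0)) dt`
  have hK := hasFDerivWithinAt_cylinderPrimitive hSc hSu hω le_rfl hx
  have hPc : Continuous fun t : ℝ => partialFDerivWithinFst S (cylinderIntegrand ω) x t := by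
    have h1 : Continuous fun t : ℝ => (cylinderCLM E F n).comp
        ((fderivWithin ℝ ω (S ×ˢ univ) (x, t)).comp (ContinuousLinearMap.inl ℝ E ℝ)) :=
      ((ContinuousLinearMap.compL ℝ _ _ _ (cylinderCLM E F n)).continuous.comp
        (((ContinuousLinearMap.compL ℝ E (E × ℝ) ((E × ℝ) [⋀^Fin (n + 1)]→L[ℝ] F)).flip
          (ContinuousLinearMap.inl ℝ E ℝ)).continuous.comp hDt))
    refine h1.congr fun t => ?_
    rw [partialFDerivWithinFst_cylinderIntegrand hSu hx (hdiff t)]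
  have hPi := hPc.intervalIntegrable (μ := volume) (0 : ℝ) 1
  have e1 : extDerivWithin (cylinderPrimitive ω) S x v = ∫ t in (0 : ℝ)..1, ∑ i : Fin (n + 1),
      (-1 : ℝ) ^ (i : ℕ) • fderivWithin ℝ ω (S ×ˢ univ) (x, t) (v i, 0)
        (Matrix.vecCons ((0 : E), (1 : ℝ)) fun j => (i.removeNth v j, 0)) := by
    rw [extDerivWithin, hK.fderivWithin (hSu x hx), ContinuousAlternatingMap.alternatizeUncurryFin_apply,
      integral_finsetSum fun i _ => by
        exact ((hDt_apply _ _).const_smul _).intervalIntegrable (μ := volume) _ _]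
    refine Finset.sum_congr rfl fun i _ => ?_
    rw [negOnePow_zsmul_eq]
    have h3 := ContinuousLinearMap.intervalIntegral_comp_comm (𝕜 := ℝ)
      (E := E →L[ℝ] E [⋀^Fin n]→L[ℝ] F) (F := F) (μ := volume) (a := (0 : ℝ)) (b := 1)
      (evalCLM (E := E) (F := F) (v i) (i.removeNth v)) hPi
    rw [evalCLM_apply] at h3
    rw [← h3, ← intervalIntegral.integral_smul]
    refine integral_congr fun t _ => ?_
    simp only [evalCLM_apply]
    rw [partialFDerivWithinFst_cylinderIntegrand hSu hx (hdiff t)]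
    rfl
  -- (2) `h(dω)(x)(v) = ∫₀¹ dω(x,t)((0,1), (v, 0)) dt`, first slot separated
  have hIc : Continuous fun t : ℝ => cylinderIntegrand (extDerivWithin ω (S ×ˢ univ)) x t := by
    have h1 : Continuous fun t : ℝ => extDerivWithin ω (S ×ˢ univ) (x, t) :=
      (ContinuousAlternatingMap.alternatizeUncurryFinCLM ℝ (E × ℝ) F).continuous.comp hDt
    exact (cylinderCLM E F (n + 1)).continuous.comp h1
  have hIi := hIc.intervalIntegrable (μ := volume) (0 : ℝ) 1
  have e2 : cylinderPrimitive (extDerivWithin ω (S ×ˢ univ)) x v = ∫ t in (0 : ℝ)..1,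
      (fderivWithin ℝ ω (S ×ˢ univ) (x, t) ((0 : E), (1 : ℝ)) (fun i => (v i, 0)) -
        ∑ i : Fin (n + 1), (-1 : ℝ) ^ (i : ℕ) • fderivWithin ℝ ω (S ×ˢ univ) (x, t) (v i, 0)
          (Matrix.vecCons ((0 : E), (1 : ℝ)) (i.removeNth fun j => (v j, 0)))) := by
    have h3 := ContinuousLinearMap.intervalIntegral_comp_comm (𝕜 := ℝ)
      (E := E [⋀^Fin (n + 1)]→L[ℝ] F) (F := F) (μ := volume) (a := (0 : ℝ)) (b := 1)
      (ContinuousAlternatingMap.apply ℝ E F v) hIi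
    rw [ContinuousAlternatingMap.apply_apply] at h3
    rw [cylinderPrimitive, ← h3]
    refine integral_congr fun t _ => ?_
    rw [ContinuousAlternatingMap.apply_apply, cylinderIntegrand_apply,
      extDerivWithin_apply_vecCons (hderW t) (hSu' _ ⟨hx, mem_univ t⟩)]
  -- (3) the alternating sums cancel; integrate `d/dt [ω(x,t)(v,0)]`
  have hderiv : ∀ t ∈ uIcc (0 : ℝ) 1, HasDerivAt (fun s : ℝ => ω (x, s) fun i => (v i, 0))
      (fderivWithin ℝ ω (S ×ˢ univ) (x, t) ((0 : E), (1 : ℝ)) fun i => (v i, 0)) t :=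
    fun t _ => hasDerivAt_apply_slice_within hx (hdiff t) _
  have hint := (hDt_apply ((0 : E), (1 : ℝ)) fun i => (v i, 0)).intervalIntegrable (μ := volume)
    (0 : ℝ) 1
  rw [e1, e2, ← intervalIntegral.integral_add hiA hiB, ← integral_eq_sub_of_hasDerivAt hderiv hint]
  exact integral_congr fun t _ => integrand_cancel' (fderivWithin ℝ ω (S ×ˢ univ) (x, t)) v

/-- **Lee's homotopy formula within `S`** (form level, the slice pull-backs `i_t^* ω` written as
`ω(x, t) ∘ (v ↦ (v, 0))`). [cite: Lee2012, Ch. 17, Lemma 17.9 (17.4)] -/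
theorem extDerivWithin_cylinderPrimitive_add
    (hSc : ∀ x ∈ S, ∃ ε > 0, Convex ℝ (S ∩ ball x ε)) (hSu : UniqueDiffOn ℝ S)
    (hω : ContDiffOn ℝ 1 ω (S ×ˢ univ)) {x : E} (hx : x ∈ S) :
    extDerivWithin (cylinderPrimitive ω) S x + cylinderPrimitive (extDerivWithin ω (S ×ˢ univ)) x =
      (ω (x, 1)).compContinuousLinearMap (ContinuousLinearMap.inl ℝ E ℝ) -
        (ω (x, 0)).compContinuousLinearMap (ContinuousLinearMap.inl ℝ E ℝ) := by
  ext v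
  rw [ContinuousAlternatingMap.add_apply, ContinuousAlternatingMap.sub_apply,
    ContinuousAlternatingMap.compContinuousLinearMap_apply,
    ContinuousAlternatingMap.compContinuousLinearMap_apply]
  exact extDerivWithin_cylinderPrimitive_add_apply hSc hSu hω hx v

/-- **Closed forms, within `S`: `d_S(hω)(x) = i₁^* ω(x) - i₀^* ω(x)`** when `d_{S×ℝ} ω = 0` along
`{x} × [0, 1]`. [cite: Lee2012, Ch. 17, Lemma 17.9 (17.4) and Prop. 17.10] -/
theorem extDerivWithin_cylinderPrimitive_of_closed
    (hSc : ∀ x ∈ S, ∃ ε > 0, Convex ℝ (S ∩ ball x ε)) (hSu : UniqueDiffOn ℝ S)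
    (hω : ContDiffOn ℝ 1 ω (S ×ˢ univ)) {x : E} (hx : x ∈ S)
    (hclosed : ∀ t ∈ Icc (0 : ℝ) 1, extDerivWithin ω (S ×ˢ univ) (x, t) = 0) :
    extDerivWithin (cylinderPrimitive ω) S x =
      (ω (x, 1)).compContinuousLinearMap (ContinuousLinearMap.inl ℝ E ℝ) -
        (ω (x, 0)).compContinuousLinearMap (ContinuousLinearMap.inl ℝ E ℝ) := by
  have h := extDerivWithin_cylinderPrimitive_add hSc hSu hω hx
  have h1 : ∫ t in (0 : ℝ)..1, cylinderIntegrand (extDerivWithin ω (S ×ˢ univ)) x t =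
      ∫ _ in (0 : ℝ)..1, (0 : E [⋀^Fin (n + 1)]→L[ℝ] F) :=
    integral_congr fun t ht => by
      rw [uIcc_of_le zero_le_one] at ht
      simp only [cylinderIntegrand, hclosed t ht, map_zero]
  have h0 : cylinderPrimitive (extDerivWithin ω (S ×ˢ univ)) x = 0 := by
    rw [cylinderPrimitive, h1, intervalIntegral.integral_zero]
  rwa [h0, add_zero] at h

end HomotopyFormula

end Literature.Analysis.Calculus
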